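import Mathlib.LinearAlgebra.Matrix.ToLinearEquiv
import Mathlib.LinearAlgebra.Matrix.Adjugate
import Literature.Computability.AlgebraicComplexity.DegenerationSpectralMonotone
import HarnessLib

/-!
# The pairing obstruction: an alternating self-pairing forbids degeneration to a full-slice tensor

Route `FarEdgeDescent` (decomposition cell `decomp-mm`, lens 2 «structural dichotomy», gen 28),
support for the aside `SubLogRate` (stmt-MatrixMultiplication-25371) through its named idea
«Q-𝔖 / transpose cashing» (`Theorems/FarEdgeDescentTwistedStarCore.lean`).

We isolate an elementary, degeneration-monotone obstruction and prove it over the tree's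
coordinate calculus of algebraic degenerations (`AlgDegeneratesTo`, BCS (15.19)):

* A tensor `s : ι → κ → μ → K` carries an **alternating self-pairing** if there is a matrix
  `J : ι → μ → K` with a left inverse such that for every middle index `b` the matrix
  `q_b(w,v) = ∑_u J u w · s u b v` is alternating (`q_b(w,w) = 0`, `q_b(w,v) = -q_b(v,w)`).
  Then for EVERY contraction vector `ψ` on the third slot the covector `ℓ = J ψ` on the first
  slot kills the contracted slice `∑_v ψ_v s(·,·,v)` — every slice of `s` is rank-deficient in the
  first slot, uniformly and polynomially in `ψ`.
* A tensor `t : ι' → κ' → μ' → K` has a **full slice** if some contraction `ψ₀` of its third slot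
  is surjective onto the first slot (certificate: a right inverse `T₀`).
* **Theorem** (`not_algDegeneratesTo_of_pairing`): if `card ι ≤ card ι'`, such an `s` does not
  degenerate to such a `t`.  Proof: square the first-slot matrix `A(ε)` of a would-be degeneration,
  produce a non-zero polynomial covector killing the contracted degeneration (left kernel if
  `det A = 0`, `(Jψ)·adj A` otherwise — this is where the pairing is used), and read off the
  trailing coefficient against the full slice of `t`.
* The hypotheses are stable under Kronecker powers when `s` also carries a SYMMETRIC invertible
  self-pairing `M` (pairing `J ⊗ M ⊗ ⋯ ⊗ M`): `not_algDegeneratesTo_kroneckerPow_of_pairing` in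
  part 2.

The instance that matters (`Theorems/FarEdgeDescentTwistedStarRigidity.lean`, which also proves the
Kronecker-power stability of the hypotheses): the twisted star
`𝔖_n(L) = (X,(Y,Y')) ↦ (XY, XᵀY')` carries both pairings (the transpose identity
`⟨Y', XY⟩ = ⟨XᵀY', Y⟩`), the coherent star `⟨n,n,2L⟩` has a full slice when `2L ≤ n`, so no
Kronecker power of the coherent star is a degeneration of the same power of the twisted star:
transpose cashing is false at every finite level and can only hold asymptotically.

All statements are over an arbitrary field `K`; no `sorry`, no new definitions.

## References

* P. Bürgisser, M. Clausen, M. A. Shokrollahi, *Algebraic Complexity Theory*, Springer (1997),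
  (15.19)–(15.25) (degeneration of order `h`). [BurgisserClausenShokrollahi1997]
* V. Strassen, *The asymptotic spectrum of tensors*, J. reine angew. Math. 384 (1988), §3.
  [Strassen1988]
-/

noncomputable section

open scoped BigOperators Polynomial

set_option linter.dupNamespace false

namespace Summit.MatrixMultiplication.MatrixMultiplication.Theorems.FarEdgeDescentPairingObstruction

open Literature.Computability.AlgebraicComplexity Polynomial

variable {K : Type*} [Field K]
variable {ι κ μ ι' κ' μ' : Type*}

/-! ## Step 1: the trailing-coefficient argument -/

/-- **Trailing coefficient against a full slice.**  If a polynomial covector `Lv` kills a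
polynomial matrix `E` whose coefficients vanish below degree `h` and equal `S₀` in degree `h`,
and `S₀` has a right inverse `T₀`, then `Lv = 0` (compare the coefficient of `ε^{d+h}`, `d` the
least trailing degree of a non-zero entry of `Lv`). [folklore] -/
theorem covector_eq_zero_of_order [Fintype ι'] [Fintype κ'] [DecidableEq ι'] (h : ℕ)
    (Lv : ι' → K[X]) (E : ι' → κ' → K[X]) (S₀ : ι' → κ' → K) (T₀ : κ' → ι' → K)
    (hE : ∀ a b j, j ≤ h → (E a b).coeff j = if j = h then S₀ a b else 0)
    (hT : ∀ a a', ∑ b, S₀ a b * T₀ b a' = if a = a' then 1 else 0)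
    (hL : ∀ b, ∑ a, Lv a * E a b = 0) : Lv = 0 := by
  classical
  by_contra hne
  have hex : ∃ a, Lv a ≠ 0 := by
    by_contra hcon
    push Not at hcon
    exact hne (funext hcon)
  -- the least trailing degree `d` among the non-zero entries, attained at `a₀`
  set F : Finset ι' := Finset.univ.filter fun a => Lv a ≠ 0 with hF
  have hFne : F.Nonempty := by
    obtain ⟨a, ha⟩ := hex
    exact ⟨a, by simp [hF, ha]⟩
  set D : Finset ℕ := F.image fun a => (Lv a).natTrailingDegree with hD
  have hDne : D.Nonempty := hFne.image _
  set d : ℕ := D.min' hDne with hd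
  obtain ⟨a₀, ha₀F, ha₀d⟩ : ∃ a₀ ∈ F, (Lv a₀).natTrailingDegree = d := by
    have hmem : d ∈ D := Finset.min'_mem D hDne
    simpa [hD] using hmem
  have ha₀ : Lv a₀ ≠ 0 := by simpa [hF] using ha₀F
  have hcoeff₀ : (Lv a₀).coeff d ≠ 0 := by
    rw [← ha₀d]
    exact trailingCoeff_nonzero_iff_nonzero.2 ha₀
  -- below `d` every entry has vanishing coefficients
  have hlow : ∀ a i, i < d → (Lv a).coeff i = 0 := by
    intro a i hi
    by_cases ha : Lv a = 0
    · simp [ha]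
    · have hle : d ≤ (Lv a).natTrailingDegree := by
        apply Finset.min'_le
        simp only [hD, Finset.mem_image]
        exact ⟨a, by simp [hF, ha], rfl⟩
      exact coeff_eq_zero_of_lt_natTrailingDegree (lt_of_lt_of_le hi hle)
  -- the coefficient of `ε^{d+h}` of `∑_a Lv a * E a b` is `∑_a (Lv a).coeff d * S₀ a b`
  have hkey : ∀ b, ∑ a, (Lv a).coeff d * S₀ a b = 0 := by
    intro b
    have h0 : (∑ a, Lv a * E a b).coeff (d + h) = 0 := by rw [hL b, coeff_zero]
    rw [finsetSum_coeff] at h0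
    rw [← h0]
    refine Finset.sum_congr rfl fun a _ => ?_
    rw [coeff_mul, Finset.sum_eq_single (d, h)]
    · rw [hE a b h le_rfl, if_pos rfl]
    · intro x hx hne'
      rw [Finset.mem_antidiagonal] at hx
      rcases lt_trichotomy x.1 d with hlt | heq | hgt
      · rw [hlow a x.1 hlt, zero_mul]
      · exfalso
        apply hne'
        have h2 : x.2 = h := by omega
        exact Prod.ext heq h2
      · have h2 : x.2 < h := by omega
        rw [hE a b x.2 h2.le, if_neg h2.ne, mul_zero]
    · intro hnot
      simp [Finset.mem_antidiagonal] at hnot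
  -- pair with the right inverse `T₀`
  have hsum : ∑ b, (∑ a, (Lv a).coeff d * S₀ a b) * T₀ b a₀ = (Lv a₀).coeff d := by
    calc ∑ b, (∑ a, (Lv a).coeff d * S₀ a b) * T₀ b a₀
        = ∑ a, (Lv a).coeff d * ∑ b, S₀ a b * T₀ b a₀ := by
          simp only [Finset.sum_mul, Finset.mul_sum, mul_assoc]
          rw [Finset.sum_comm]
      _ = ∑ a, (Lv a).coeff d * (if a = a₀ then 1 else 0) := by
          refine Finset.sum_congr rfl fun a _ => ?_
          rw [hT a a₀]
      _ = (Lv a₀).coeff d := by simp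
  have : ∑ b, (∑ a, (Lv a).coeff d * S₀ a b) * T₀ b a₀ = 0 := by simp [hkey]
  rw [hsum] at this
  exact hcoeff₀ this

/-! ## Step 2: the alternating identity survives extension of scalars to `K[ε]` -/

/-- **An alternating self-pairing kills every polynomial contraction**: if the matrices
`q_b = Jᵀ s(·,b,·)` are alternating, then for every `ψ ∈ K[ε]^μ` the covector `Jψ` annihilates
the contracted slice `∑_v ψ_v s(·,b,v)` (sum the quadratic form over the involution
`(w,v) ↦ (v,w)`). [folklore] -/
theorem pairing_contraction_eq_zero [Fintype ι] [Fintype μ] (J : ι → μ → K)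
    (s : ι → κ → μ → K) (alt1 : ∀ b w, ∑ u, J u w * s u b w = 0)
    (alt2 : ∀ b w v, ∑ u, J u w * s u b v = -(∑ u, J u v * s u b w)) (ψ : μ → K[X]) (b : κ) :
    ∑ u, (∑ w, C (J u w) * ψ w) * (∑ v, ψ v * C (s u b v)) = 0 := by
  classical
  -- rewrite as a sum over pairs `(w, v)` of `ψ w * ψ v * C (q_b w v)`
  have hre : ∑ u, (∑ w, C (J u w) * ψ w) * (∑ v, ψ v * C (s u b v)) =
      ∑ p : μ × μ, ψ p.1 * ψ p.2 * C (∑ u, J u p.1 * s u b p.2) := by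
    calc ∑ u, (∑ w, C (J u w) * ψ w) * (∑ v, ψ v * C (s u b v))
        = ∑ u, ∑ w, ∑ v, ψ w * ψ v * (C (J u w) * C (s u b v)) := by
          refine Finset.sum_congr rfl fun u _ => ?_
          rw [Finset.sum_mul_sum]
          refine Finset.sum_congr rfl fun w _ => Finset.sum_congr rfl fun v _ => ?_
          ring
      _ = ∑ w, ∑ v, ∑ u, ψ w * ψ v * (C (J u w) * C (s u b v)) := by
          rw [Finset.sum_comm]
          refine Finset.sum_congr rfl fun w _ => ?_
          rw [Finset.sum_comm]
      _ = ∑ w, ∑ v, ψ w * ψ v * C (∑ u, J u w * s u b v) := by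
          refine Finset.sum_congr rfl fun w _ => Finset.sum_congr rfl fun v _ => ?_
          rw [← Finset.mul_sum, map_sum]
          simp only [map_mul]
      _ = ∑ p : μ × μ, ψ p.1 * ψ p.2 * C (∑ u, J u p.1 * s u b p.2) := by
          rw [← Finset.sum_product']
          rfl
  rw [hre]
  refine Finset.sum_ninvolution Prod.swap ?_ ?_ (fun p => Finset.mem_univ _) fun p => p.swap_swap
  · intro p
    simp only [Prod.fst_swap, Prod.snd_swap]
    rw [alt2 b p.2 p.1, C_neg]
    ring
  · intro p hp heq
    apply hp
    have h1 : p.1 = p.2 := by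
      have := congrArg Prod.snd heq
      simpa using this
    rw [h1, alt1 b p.2, C_0, mul_zero]

/-! ## Step 3: the obstruction -/

/-- Rearranging a covector applied to a doubly-indexed bilinear expression. [folklore] -/
private theorem sum_mul_sum_sum_factor {R : Type*} [CommSemiring R] [Fintype ι] [Fintype κ] [Fintype ι']
    (v : ι' → R) (A : ι' → ι → R) (Bb : κ → R) (S : ι → κ → R) :
    ∑ a', v a' * (∑ a, ∑ b, A a' a * Bb b * S a b) =
      ∑ a, ∑ b, (∑ a', v a' * A a' a) * Bb b * S a b := by
  calc ∑ a', v a' * (∑ a, ∑ b, A a' a * Bb b * S a b)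
      = ∑ a', ∑ a, ∑ b, v a' * A a' a * Bb b * S a b := by
        refine Finset.sum_congr rfl fun a' _ => ?_
        rw [Finset.mul_sum]
        refine Finset.sum_congr rfl fun a _ => ?_
        rw [Finset.mul_sum]
        refine Finset.sum_congr rfl fun b _ => ?_
        ring
    _ = ∑ a, ∑ b, ∑ a', v a' * A a' a * Bb b * S a b := by
        rw [Finset.sum_comm]
        refine Finset.sum_congr rfl fun a _ => ?_
        rw [Finset.sum_comm]
    _ = ∑ a, ∑ b, (∑ a', v a' * A a' a) * Bb b * S a b := by
        refine Finset.sum_congr rfl fun a _ => Finset.sum_congr rfl fun b _ => ?_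
        rw [Finset.sum_mul, Finset.sum_mul]

/-- **The pairing obstruction.**  Let `s` carry an alternating self-pairing `J` with left inverse
`J'` (`alt1`, `alt2`: the matrices `∑_u J u w · s u b v` are alternating in `(w,v)`), and let `t`
have a full slice (`ψ₀` with right inverse `T₀` of the contracted slice
`S₀ a b = ∑_c ψ₀ c · t a b c`).  If the first slot of `s` is not larger than that of `t`, then
`t` is NOT a degeneration of `s` (BCS (15.19)): `¬ (t ⊴ s)`.  Invariant behind it: the maximal
first-slot rank of a third-slot contraction, which is `< card ι` for every slice of `s` and
`= card ι'` for the slice `ψ₀` of `t`, and which cannot increase under degeneration.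
[cite: BurgisserClausenShokrollahi1997, (15.19)] -/
theorem not_algDegeneratesTo_of_pairing [Fintype ι] [Fintype κ] [Fintype μ] [Fintype ι']
    [Fintype κ'] [Fintype μ'] [DecidableEq μ] [DecidableEq ι'] [Nonempty ι'] (s : ι → κ → μ → K)
    (t : ι' → κ' → μ' → K) (J : ι → μ → K) (J' : μ → ι → K)
    (hJ' : ∀ w w', ∑ u, J' w' u * J u w = if w' = w then 1 else 0)
    (alt1 : ∀ b w, ∑ u, J u w * s u b w = 0)
    (alt2 : ∀ b w v, ∑ u, J u w * s u b v = -(∑ u, J u v * s u b w))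
    (ψ₀ : μ' → K) (T₀ : κ' → ι' → K)
    (hT : ∀ a a', ∑ b, (∑ c, ψ₀ c * t a b c) * T₀ b a' = if a = a' then 1 else 0)
    (hcard : Fintype.card ι ≤ Fintype.card ι') :
    ¬ AlgDegeneratesTo s t := by
  classical
  rintro ⟨h, A, B, C, hABC⟩
  obtain ⟨e⟩ := Function.Embedding.nonempty_of_card_le hcard
  -- polynomial data of the contracted degeneration
  set ψ : μ → K[X] := fun c => ∑ c', Polynomial.C (ψ₀ c') * C c' c with hψdef
  set Sψ : ι → κ → K[X] := fun a b => ∑ c, ψ c * Polynomial.C (s a b c) with hSψ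
  set ℓ : ι → K[X] := fun a => ∑ w, Polynomial.C (J a w) * ψ w with hℓdef
  set E : ι' → κ' → K[X] := fun a' b' =>
    ∑ c', Polynomial.C (ψ₀ c') * (∑ a, ∑ b, ∑ c, A a' a * B b' b * C c' c * Polynomial.C (s a b c))
    with hEdef
  have hE : ∀ a' b' j, j ≤ h →
      (E a' b').coeff j = if j = h then (∑ c', ψ₀ c' * t a' b' c') else 0 := by
    intro a' b' j hj
    have hc : ∀ c', (Polynomial.C (ψ₀ c') * (∑ a, ∑ b, ∑ c,
        A a' a * B b' b * C c' c * Polynomial.C (s a b c))).coeff j =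
        ψ₀ c' * (if j = h then t a' b' c' else 0) := by
      intro c'
      rw [coeff_C_mul, hABC a' b' c' j hj]
    simp only [hEdef]
    rw [finsetSum_coeff]
    simp only [hc]
    by_cases hjh : j = h
    · simp [hjh]
    · simp [hjh]
  have hEfac : ∀ a' b', E a' b' = ∑ a, ∑ b, A a' a * B b' b * Sψ a b := by
    intro a' b'
    simp only [hEdef, hSψ, hψdef]
    calc ∑ c', Polynomial.C (ψ₀ c') *
          (∑ a, ∑ b, ∑ c, A a' a * B b' b * C c' c * Polynomial.C (s a b c))
        = ∑ c', ∑ a, ∑ b, ∑ c,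
            Polynomial.C (ψ₀ c') * (A a' a * B b' b * C c' c * Polynomial.C (s a b c)) := by
          refine Finset.sum_congr rfl fun c' _ => ?_
          simp only [Finset.mul_sum]
      _ = ∑ a, ∑ b, ∑ c, ∑ c',
            Polynomial.C (ψ₀ c') * (A a' a * B b' b * C c' c * Polynomial.C (s a b c)) := by
          rw [Finset.sum_comm]
          refine Finset.sum_congr rfl fun a _ => ?_
          rw [Finset.sum_comm]
          refine Finset.sum_congr rfl fun b _ => ?_
          rw [Finset.sum_comm]
      _ = ∑ a, ∑ b, A a' a * B b' b *
            ∑ c, (∑ c', Polynomial.C (ψ₀ c') * C c' c) * Polynomial.C (s a b c) := by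
          refine Finset.sum_congr rfl fun a _ => Finset.sum_congr rfl fun b _ => ?_
          rw [Finset.mul_sum]
          refine Finset.sum_congr rfl fun c _ => ?_
          rw [Finset.sum_mul, Finset.mul_sum]
          refine Finset.sum_congr rfl fun c' _ => ?_
          ring
  have hpair : ∀ b, ∑ a, ℓ a * Sψ a b = 0 := fun b =>
    pairing_contraction_eq_zero J s alt1 alt2 ψ b
  -- square the first-slot matrix along the embedding `e : ι ↪ ι'`
  set A' : Matrix ι' ι' K[X] := fun a' x => ∑ a, if e a = x then A a' a else 0 with hA'def
  have hA'col : ∀ (v : ι' → K[X]) (a : ι), (Matrix.vecMul v A') (e a) = ∑ a', v a' * A a' a := by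
    intro v a
    simp only [Matrix.vecMul, dotProduct, hA'def, e.injective.eq_iff, Finset.sum_ite_eq',
      Finset.mem_univ, if_true]
  -- it suffices to produce a non-zero polynomial covector killing `E`
  suffices key : ∃ Lv : ι' → K[X], Lv ≠ 0 ∧ ∀ b', ∑ a', Lv a' * E a' b' = 0 by
    obtain ⟨Lv, hne, hLv⟩ := key
    exact hne (covector_eq_zero_of_order h Lv E _ T₀ hE hT hLv)
  by_cases hdet : A'.det = 0
  · -- singular case: a left-kernel vector of `A'`
    obtain ⟨Lv, hne, hLv⟩ := Matrix.exists_vecMul_eq_zero_iff.2 hdet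
    refine ⟨Lv, hne, fun b' => ?_⟩
    have h0 : ∀ a, ∑ a', Lv a' * A a' a = 0 := by
      intro a
      rw [← hA'col, hLv]
      rfl
    simp only [hEfac]
    rw [sum_mul_sum_sum_factor]
    simp [h0]
  · by_cases hψ : ψ = 0
    · -- degenerate contraction: then the full slice of `t` would vanish
      exfalso
      obtain ⟨a₀⟩ := ‹Nonempty ι'›
      have hS0 : ∀ a' b', ∑ c', ψ₀ c' * t a' b' c' = 0 := by
        intro a' b'
        have h1 := hE a' b' h le_rfl
        rw [if_pos rfl] at h1
        rw [← h1, hEfac]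
        have : ∀ a b, Sψ a b = 0 := by
          intro a b
          simp only [hSψ]
          refine Finset.sum_eq_zero fun c _ => ?_
          rw [show ψ c = 0 from congr_fun hψ c, zero_mul]
        simp [this]
      have h2 := hT a₀ a₀
      rw [if_pos rfl] at h2
      have h3 : ∑ b, (∑ c, ψ₀ c * t a₀ b c) * T₀ b a₀ = 0 := by simp [hS0]
      rw [h3] at h2
      exact zero_ne_one h2
    · -- regular case: push the pairing covector `ℓ = Jψ ≠ 0` through `adj A'`
      have hℓ : ℓ ≠ 0 := by
        intro hℓ0
        apply hψ
        funext w'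
        have hrec : ψ w' = ∑ a, Polynomial.C (J' w' a) * ℓ a := by
          simp only [hℓdef]
          calc ψ w' = ∑ w, (if w' = w then (1 : K[X]) else 0) * ψ w := by
                  simp
            _ = ∑ w, (∑ a, Polynomial.C (J' w' a) * Polynomial.C (J a w)) * ψ w := by
                  refine Finset.sum_congr rfl fun w _ => ?_
                  congr 1
                  rw [show (∑ a, Polynomial.C (J' w' a) * Polynomial.C (J a w)) =
                      Polynomial.C (∑ a, J' w' a * J a w) by
                    rw [map_sum]; simp only [map_mul], hJ' w w']
                  split_ifs <;> simp
            _ = ∑ a, Polynomial.C (J' w' a) * ∑ w, Polynomial.C (J a w) * ψ w := by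
                  simp only [Finset.sum_mul, Finset.mul_sum, mul_assoc]
                  rw [Finset.sum_comm]
        rw [hrec]
        simp [hℓ0]
      obtain ⟨a₀, ha₀⟩ : ∃ a, ℓ a ≠ 0 := by
        by_contra hcon
        push Not at hcon
        exact hℓ (funext hcon)
      set m' : ι' → K[X] := fun x => ∑ a, if e a = x then ℓ a else 0 with hm'def
      have hm'e : ∀ a, m' (e a) = ℓ a := by
        intro a
        simp only [hm'def, e.injective.eq_iff, Finset.sum_ite_eq', Finset.mem_univ, if_true]
      have hLA : Matrix.vecMul (Matrix.vecMul m' A'.adjugate) A' = A'.det • m' := by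
        rw [Matrix.vecMul_vecMul, Matrix.adjugate_mul, Matrix.vecMul_smul, Matrix.vecMul_one]
      refine ⟨Matrix.vecMul m' A'.adjugate, ?_, fun b' => ?_⟩
      · intro h0
        rw [h0, Matrix.zero_vecMul] at hLA
        have h2 := congr_fun hLA (e a₀)
        simp only [Pi.zero_apply, Pi.smul_apply, smul_eq_mul, hm'e] at h2
        exact (mul_ne_zero hdet ha₀) h2.symm
      · have hcol : ∀ a, ∑ a', (Matrix.vecMul m' A'.adjugate) a' * A a' a = A'.det * ℓ a := by
          intro a
          rw [← hA'col, hLA]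
          simp [hm'e]
        simp only [hEfac]
        rw [sum_mul_sum_sum_factor]
        simp only [hcol]
        calc ∑ a, ∑ b, A'.det * ℓ a * B b' b * Sψ a b
            = A'.det * ∑ b, B b' b * ∑ a, ℓ a * Sψ a b := by
              rw [Finset.sum_comm, Finset.mul_sum]
              refine Finset.sum_congr rfl fun b _ => ?_
              rw [Finset.mul_sum, Finset.mul_sum]
              refine Finset.sum_congr rfl fun a _ => ?_
              ring
          _ = 0 := by simp [hpair]

end Summit.MatrixMultiplication.MatrixMultiplication.Theorems.FarEdgeDescentPairingObstruction
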